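import Mathlib
import Summits.Ventures.PercRepro2.Defs
import Summits.Ventures.PercRepro2.Graph
import Summits.Ventures.PercRepro2.OneColourSwitch
import Summits.Ventures.PercRepro2.RegionHubSign
import Summits.Ventures.PercRepro2.SideSwitch
import Summits.Ventures.PercRepro2.SideSwitchFibre
import Summits.Ventures.PercRepro2.SideSwitchMono
import Summits.Ventures.PercRepro2.SideSwitchClosed
import Summits.Ventures.PercRepro2.SideSwitchComps
import Summits.Ventures.PercRepro2.SideSwitchCompsFibre
import Summits.Ventures.PercRepro2.M9NoPocketDefs
import Summits.Ventures.PercRepro2.M9NoPocketWorld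
import Summits.Ventures.PercRepro2.M9NoPocketWorldD
import Summits.Ventures.PercRepro2.M9NoPocketLegal
import Summits.Ventures.PercRepro2.M9NoPocketCompl

/-!
# The single-`d` class without a pocket — the complement identity (blind cell PercRepro2,
p3 g20, 2026-08-27; `proofs/P3-CPNC.md` §17c (vi))

The colour flip of the assignment `x` of a representative `ρ` is, on every edge except the
`r`–`s` copies, the assignment of the dual vector `cdual ρ x` to the outside-flipped
representative `flipOp ρ` (`compl_assignX_eq_off_rs`): every edge touching a block is flipped
by exactly one of the two complementary block sets, every `T`-edge by exactly one of the two
complementary `T`-edge sets, every edge inside the unexplored part by the outside flip, and no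
other edge exists besides the `r`–`s` copies (no pocket).  Hence `p ~_W q` in the assignment
`x` is `p ~_Y q` in the dual assignment (`conn_pq_compl_assignX`); the dual vector of a legal
vector is legal (`cdual_mem_L4`).  Own work; std axioms.
-/

namespace Summit.Ventures.PercRepro2

namespace NoPocket

open Finset Classical RegionHub OneColourSwitch SideSwitch

variable {V : Type*} {E : Type*}

section Compl2

variable [Fintype V] [DecidableEq V] [Fintype E] [DecidableEq E]

variable {ends : E → Sym2 V}

omit [Fintype E] [DecidableEq E] in
/-- Two adjacent sided vertices of `G − d` lie in the same block. -/
lemma block_eq_of_edge {d r s : V} {ρ : Config E} {y z : V} (hy : y ∈ A0 (endsD ends d) r s ρ)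
    (hz : z ∈ A0 (endsD ends d) r s ρ) {e : E} (he : ends e = s(y, z)) (hr : d ≠ r) (hs : d ≠ s) :
    compIn (endsD ends d) (↑(A0 (endsD ends d) r s ρ) : Set V) y =
      compIn (endsD ends d) (↑(A0 (endsD ends d) r s ρ) : Set V) z := by
  have hyd : y ≠ d := by
    rintro rfl
    obtain ⟨hU, _, _⟩ := mem_A0.1 hy
    rcases hU with h | h
    · exact not_mem_K2_endsD hr hs ρ h
    · exact not_mem_M2_endsD hr hs ρ h
  have hzd : z ≠ d := by
    rintro rfl
    obtain ⟨hU, _, _⟩ := mem_A0.1 hz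
    rcases hU with h | h
    · exact not_mem_K2_endsD hr hs ρ h
    · exact not_mem_M2_endsD hr hs ρ h
  have hends : endsD ends d e = s(y, z) := by
    rw [endsD_of_notMem (notMem_of_ends_ne he hyd hzd), he]
  have hchi : chi (endsD ends d) (↑(A0 (endsD ends d) r s ρ) : Set V) e = true :=
    chi_eq_true_iff.2 ⟨y, Finset.mem_coe.2 hy, z, Finset.mem_coe.2 hz, hends⟩
  exact (compIn_eq_of_mem (mem_compIn.2 (conn_of_openAdj ⟨e, hchi, hends⟩))).symm

/-- An edge at a block vertex touches a union of blocks iff that block is among them. -/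
lemma mem_touches_unionT_iff_of_block {p q r s d : V} {ρ : Config E}
    (hρ : ρ ∈ RepD ends p q r s d) (hr : d ≠ r) (hs : d ≠ s) {T : Finset (Finset V)}
    (hT : T ⊆ blocks ends d r s ρ) {C : Finset V} (hC : C ∈ blocks ends d r s ρ) {y : V}
    (hy : y ∈ C) {e : E} {z : V} (he : ends e = s(y, z)) :
    e ∈ touches ends (↑(unionT T) : Set V) ↔ C ∈ T := by
  constructor
  · rintro ⟨w, hw, w', hww'⟩
    have hwT : w ∈ unionT T := Finset.mem_coe.1 hw
    have hwA : w ∈ A0 (endsD ends d) r s ρ := unionT_subset_A0 (ends := endsD ends d) hT hwT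
    rw [he, Sym2.eq_iff] at hww'
    have hyA : y ∈ A0 (endsD ends d) r s ρ := subset_A0_of_mem_comps (ends := endsD ends d) hC hy
    rcases hww' with ⟨h1, _⟩ | ⟨_, h2⟩
    · rw [← h1] at hwT
      exact block_mem_of_mem_unionT hρ hT hC hy hwT
    · -- the other endpoint `z = w` is a block vertex of the same block
      rw [← h2] at hwT hwA
      have hCeq := eq_compIn_of_mem_comps (ends := endsD ends d) hC hy
      have hsame := block_eq_of_edge hyA hwA he hr hs
      obtain ⟨hC', hzC'⟩ := block_of_mem_A0 hwA
      have hCC' : C = compIn (endsD ends d) (↑(A0 (endsD ends d) r s ρ) : Set V) z := by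
        rw [hCeq, hsame]
      rw [hCC']
      exact block_mem_of_mem_unionT hρ hT hC' hzC' hwT
  · intro hCT
    exact ⟨y, Finset.mem_coe.2 (mem_unionT.2 ⟨C, hCT, hy⟩), z, he⟩

/-- An edge at a block vertex is not a `T`-edge. -/
lemma not_mem_Tset_of_block_edge {p q r s d : V} {ρ : Config E} (hρ : ρ ∈ RepD ends p q r s d)
    (hr : d ≠ r) (hs : d ≠ s) {C : Finset V} (hC : C ∈ blocks ends d r s ρ) {y : V} (hy : y ∈ C)
    {e : E} {z : V} (he : ends e = s(y, z)) : e ∉ Tset ends d r s := by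
  obtain ⟨hyr, hys, hyd⟩ := block_vertex_ne hρ hC hy hr hs
  intro h
  rcases mem_Tset.1 h with h' | h' <;> rw [he, Sym2.eq_iff] at h'
  · rcases h' with ⟨h1, _⟩ | ⟨h1, _⟩
    · exact hyd h1
    · exact hyr h1
  · rcases h' with ⟨h1, _⟩ | ⟨h1, _⟩
    · exact hyd h1
    · exact hys h1

/-- **The complement identity, pointwise**: off the `r`–`s` copies, the colour flip of the
assignment `x` is the assignment of the dual vector to the outside-flipped representative. -/
theorem compl_assignX_eq_off_rs {p q r s d : V} (hnp : NoPocketAt ends d r s) (hr : d ≠ r)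
    (hs : d ≠ s) {ρ : Config E} (hρ : ρ ∈ RepD ends p q r s d)
    {x : Finset (Finset V) × Finset E} (hT : x.1 ⊆ blocks ends d r s ρ)
    (hF : x.2 ⊆ Tset ends d r s) {e : E} (he : e ∉ within ends ({r, s} : Set V)) :
    OneColourSwitch.compl (assignX ends x ρ) e = assignX ends (cdual ends d r s ρ x) (flipOp ends d r s ρ) e := by
  obtain ⟨hsep, hM, _⟩ := mem_RepD.1 hρ
  obtain ⟨y, z, hyz⟩ : ∃ y z, ends e = s(y, z) := Sym2.ind (fun y z => ⟨y, z, rfl⟩) (ends e)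
  have hzy : ends e = s(z, y) := by rw [hyz, Sym2.eq_swap]
  have hTc : (cdual ends d r s ρ x).1 ⊆ blocks ends d r s ρ := Finset.sdiff_subset
  have hFc : (cdual ends d r s ρ x).2 ⊆ Tset ends d r s := Finset.sdiff_subset
  -- case A: an endpoint is a block vertex
  by_cases hyA : y ∈ A0 (endsD ends d) r s ρ
  · set C := compIn (endsD ends d) (↑(A0 (endsD ends d) r s ρ) : Set V) y with hCdef
    obtain ⟨hC, hyC⟩ := block_of_mem_A0 hyA
    have h1 := mem_touches_unionT_iff_of_block hρ hr hs hT hC hyC hyz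
    have h2 := mem_touches_unionT_iff_of_block hρ hr hs hTc hC hyC hyz
    have hnotT : e ∉ Tset ends d r s := not_mem_Tset_of_block_edge hρ hr hs hC hyC hyz
    have hnotO : e ∉ within ends (Oprime ends d r s ρ) :=
      block_edge_not_mem_within_Oprime hC hyC hyz
    have hFe : flipF x.2 ρ e = ρ e := flipF_of_notMem (fun h => hnotT (hF h))
    have hFe' : flipF (cdual ends d r s ρ x).2 (flipOp ends d r s ρ) e = ρ e := by
      rw [flipF_of_notMem (fun h => hnotT (hFc h)), flipOp_of_notMem hnotO]
    simp only [OneColourSwitch.compl, assignX]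
    by_cases hCx : C ∈ x.1
    · have hCc : C ∉ (cdual ends d r s ρ x).1 := fun h => (Finset.mem_sdiff.1 h).2 hCx
      rw [flipTouch_of_mem ends (h1.2 hCx), flipTouch_of_notMem ends (fun h => hCc (h2.1 h)), hFe,
        hFe', Bool.not_not]
    · have hCc : C ∈ (cdual ends d r s ρ x).1 := Finset.mem_sdiff.2 ⟨hC, hCx⟩
      rw [flipTouch_of_notMem ends (fun h => hCx (h1.1 h)), flipTouch_of_mem ends (h2.2 hCc), hFe,
        hFe']
  by_cases hzA : z ∈ A0 (endsD ends d) r s ρ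
  · set C := compIn (endsD ends d) (↑(A0 (endsD ends d) r s ρ) : Set V) z with hCdef
    obtain ⟨hC, hzC⟩ := block_of_mem_A0 hzA
    have h1 := mem_touches_unionT_iff_of_block hρ hr hs hT hC hzC hzy
    have h2 := mem_touches_unionT_iff_of_block hρ hr hs hTc hC hzC hzy
    have hnotT : e ∉ Tset ends d r s := not_mem_Tset_of_block_edge hρ hr hs hC hzC hzy
    have hnotO : e ∉ within ends (Oprime ends d r s ρ) :=
      block_edge_not_mem_within_Oprime hC hzC hzy
    have hFe : flipF x.2 ρ e = ρ e := flipF_of_notMem (fun h => hnotT (hF h))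
    have hFe' : flipF (cdual ends d r s ρ x).2 (flipOp ends d r s ρ) e = ρ e := by
      rw [flipF_of_notMem (fun h => hnotT (hFc h)), flipOp_of_notMem hnotO]
    simp only [OneColourSwitch.compl, assignX]
    by_cases hCx : C ∈ x.1
    · have hCc : C ∉ (cdual ends d r s ρ x).1 := fun h => (Finset.mem_sdiff.1 h).2 hCx
      rw [flipTouch_of_mem ends (h1.2 hCx), flipTouch_of_notMem ends (fun h => hCc (h2.1 h)), hFe,
        hFe', Bool.not_not]
    · have hCc : C ∈ (cdual ends d r s ρ x).1 := Finset.mem_sdiff.2 ⟨hC, hCx⟩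
      rw [flipTouch_of_notMem ends (fun h => hCx (h1.1 h)), flipTouch_of_mem ends (h2.2 hCc), hFe,
        hFe']
  -- no endpoint is a block vertex: the edge touches no block
  have hnt : ∀ T : Finset (Finset V), T ⊆ blocks ends d r s ρ →
      e ∉ touches ends (↑(unionT T) : Set V) := by
    intro T hT' ⟨w, hw, w', hww'⟩
    have hwA : w ∈ A0 (endsD ends d) r s ρ :=
      unionT_subset_A0 (ends := endsD ends d) hT' (Finset.mem_coe.1 hw)
    rw [hyz, Sym2.eq_iff] at hww'
    rcases hww' with ⟨h1, _⟩ | ⟨_, h2⟩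
    · rw [← h1] at hwA; exact hyA hwA
    · rw [← h2] at hwA; exact hzA hwA
  simp only [OneColourSwitch.compl, assignX]
  rw [flipTouch_of_notMem ends (hnt _ hT), flipTouch_of_notMem ends (hnt _ hTc)]
  -- case B: a `T`-edge
  by_cases heT : e ∈ Tset ends d r s
  · have hnotO : e ∉ within ends (Oprime ends d r s ρ) := Tset_not_mem_within_Oprime ρ heT
    by_cases hex : e ∈ x.2
    · have hexc : e ∉ (cdual ends d r s ρ x).2 := fun h => (Finset.mem_sdiff.1 h).2 hex
      rw [flipF_of_mem hex, flipF_of_notMem hexc, flipOp_of_notMem hnotO, Bool.not_not]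
    · have hexc : e ∈ (cdual ends d r s ρ x).2 := Finset.mem_sdiff.2 ⟨heT, hex⟩
      rw [flipF_of_notMem hex, flipF_of_mem hexc, flipOp_of_notMem hnotO]
  -- case C: not a `T`-edge, touching no block: inside `Oprime`, or an `r`–`s` copy
  have hex : e ∉ x.2 := fun h => heT (hF h)
  have hexc : e ∉ (cdual ends d r s ρ x).2 := fun h => heT (hFc h)
  rw [flipF_of_notMem hex, flipF_of_notMem hexc]
  have hcases : ∀ w, w ∉ A0 (endsD ends d) r s ρ → w = r ∨ w = s ∨ w ∈ Oprime ends d r s ρ := by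
    intro w hw
    rcases vertex_cases (ends := endsD ends d) (r := r) (s := s) ρ w with h | h | h | h
    · exact Or.inl h
    · exact Or.inr (Or.inl h)
    · exact (hw h).elim
    · exact Or.inr (Or.inr h)
  have hmark : ∀ w, w = r ∨ w = s → w ∈ ({r, s} : Set V) := by
    rintro w (h | h)
    · exact Set.mem_insert_iff.2 (Or.inl h)
    · exact Set.mem_insert_iff.2 (Or.inr (Set.mem_singleton_iff.2 h))
  -- an edge from `r` or `s` to `Oprime` does not exist
  have hno : ∀ w w', ends e = s(w, w') → w = r ∨ w = s → w' ∈ Oprime ends d r s ρ → False := by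
    intro w w' hww' hw hw'
    obtain ⟨hwK', hwM'⟩ := mem_Oprime.1 hw'
    by_cases hw'd : w' = d
    · -- a `T`-edge
      exact heT (mem_Tset.2 (by
        rcases hw with rfl | rfl
        · exact Or.inl (by rw [hww', hw'd, Sym2.eq_swap])
        · exact Or.inr (by rw [hww', hw'd, Sym2.eq_swap])))
    · have hwd : w ≠ d := by rcases hw with rfl | rfl; exact hr.symm; exact hs.symm
      have hd : d ∉ ends e := notMem_of_ends_ne hww' hwd hw'd
      have hends' : endsD ends d e = s(w, w') := by rw [endsD_of_notMem hd, hww']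
      rcases hw with rfl | rfl
      · exact not_edge_r_outside (ends := endsD ends d) hsep hwK' hwM' hends'
      · exact not_edge_s_outside (ends := endsD ends d) hsep hwK' hwM' hends'
  rcases hcases y hyA with hy' | hy' | hyO
  · rcases hcases z hzA with hz' | hz' | hzO
    · exact (he ⟨y, hmark y (Or.inl hy'), z, hmark z (Or.inl hz'), hyz⟩).elim
    · exact (he ⟨y, hmark y (Or.inl hy'), z, hmark z (Or.inr hz'), hyz⟩).elim
    · exact (hno y z hyz (Or.inl hy') hzO).elim
  · rcases hcases z hzA with hz' | hz' | hzO
    · exact (he ⟨y, hmark y (Or.inr hy'), z, hmark z (Or.inl hz'), hyz⟩).elim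
    · exact (he ⟨y, hmark y (Or.inr hy'), z, hmark z (Or.inr hz'), hyz⟩).elim
    · exact (hno y z hyz (Or.inr hy') hzO).elim
  · rcases hcases z hzA with hz' | hz' | hzO
    · exact (hno z y hzy (Or.inl hz') hyO).elim
    · exact (hno z y hzy (Or.inr hz') hyO).elim
    · have hw : e ∈ within ends (Oprime ends d r s ρ) := ⟨y, hyO, z, hzO, hyz⟩
      rw [flipOp_of_mem hw]

end Compl2

end NoPocket

end Summit.Ventures.PercRepro2
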